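import Mathlib
import Summits.ValiantsHypothesis.ValiantsHypothesis.Theorems.RigidityForcesSymmetryRankRigidMinimalReprLaplaceFiveSectorSplitDefs
import Summits.ValiantsHypothesis.ValiantsHypothesis.Theorems.RigidityForcesSymmetryRankRigidMinimalReprLaplaceFiveSlackCoherence

/-!
# ValiantsHypothesis / RigidityForcesSymmetry — crux `LaplaceOptimalFive` (stmt-ValiantsHypothesis-24813), crux idea
`young-shadow` (K1): **SLOT RELABELLING** of side-symmetric split decompositions

The three hypotheses of `LaplaceOptimal 5` in the young-shadow currency (`IsSplitDecomposition`, `SideSymmetric`) and the Laplace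
weight are invariant under a relabelling of the five SLOTS: for `π : Equiv.Perm (Fin 5)` replace `S t` by its image `(S t).image π`
and read every factor at `v ∘ π`.  This turns a K1 statement proved for ONE placement of a support (e.g. the canonical 4-cycle
`{01,12,23,03}` of ✓ `LaplaceFiveSumRigidC4.sideSym_C4canon`, or the canonical star / `K₂,₃` / `K₄ − e`) into the statement for every
placement in the same `S₅`-orbit.

Honest framing.  Bookkeeping only; K1, S2′, `LaplaceOptimalFive` (OPEN · CONTESTED 72/120), `RankRigidMinimalRepr`, `VP ≠ VNP` are NOT
proved.  No definitions, no `sorry`; Mathlib + tree only.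
-/

set_option linter.dupNamespace false

namespace Summit.ValiantsHypothesis.ValiantsHypothesis.Theorems.RigidityForcesSymmetryRankRigidMinimalRepr

namespace LaplaceFiveRelabel

open Finset LaplaceFiveSectorSplit

variable {N : ℕ}

/-- Relabelling the slots by `π` preserves `IsSplitDecomposition`. [folklore] -/
theorem isSplitDecomposition_relabel (T : Finset (Fin N)) (S : Fin N → Finset (Fin 5))
    (u w : Fin N → (Fin 5 → Fin 5) → ℂ) (π : Equiv.Perm (Fin 5)) (hdec : IsSplitDecomposition T S u w) :
    IsSplitDecomposition T (fun t => (S t).image ⇑π) (fun t v => u t (v ∘ ⇑π)) (fun t v => w t (v ∘ ⇑π)) := by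
  obtain ⟨hu, hw, hid⟩ := hdec
  refine ⟨?_, ?_, ?_⟩
  · intro t v v' h
    refine hu t _ _ fun i hi => ?_
    exact h (π i) (Finset.mem_image_of_mem _ hi)
  · intro t v v' h
    refine hw t _ _ fun i hi => ?_
    refine h (π i) fun hm => hi ?_
    obtain ⟨j, hj, hji⟩ := Finset.mem_image.mp hm
    exact π.injective hji ▸ hj
  · intro v
    have h := hid (v ∘ ⇑π)
    rw [if_congr (Equiv.injective_comp π v) rfl rfl] at h
    exact h

/-- Relabelling the slots by `π` preserves `SideSymmetric`. [folklore] -/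
theorem sideSymmetric_relabel (T : Finset (Fin N)) (S : Fin N → Finset (Fin 5))
    (u w : Fin N → (Fin 5 → Fin 5) → ℂ) (π : Equiv.Perm (Fin 5)) (hsym : SideSymmetric T S u w) :
    SideSymmetric T (fun t => (S t).image ⇑π) (fun t v => u t (v ∘ ⇑π)) (fun t v => w t (v ∘ ⇑π)) := by
  intro t ht
  obtain ⟨h1, h2⟩ := hsym t ht
  refine ⟨slotInvariantOn_comp π h1, ?_⟩
  have h2' := slotInvariantOn_comp π h2
  rwa [image_compl_perm'] at h2'

/-- Relabelling the slots does not change the Laplace weight. [folklore] -/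
theorem laplaceWeight_relabel (T : Finset (Fin N)) (S : Fin N → Finset (Fin 5)) (π : Equiv.Perm (Fin 5)) :
    laplaceWeight T (fun t => (S t).image ⇑π) = laplaceWeight T S := by
  unfold laplaceWeight
  refine Finset.sum_congr rfl fun t _ => ?_
  rw [Finset.card_image_of_injective _ π.injective]

/-- The image of a pair under a slot permutation. [folklore] -/
theorem image_pair (π : Equiv.Perm (Fin 5)) (a b : Fin 5) :
    ({a, b} : Finset (Fin 5)).image ⇑π = {π a, π b} := by
  rw [Finset.image_insert, Finset.image_singleton]

/-- **Transfer of a weight bound along a relabelling**: if every side-symmetric split decomposition whose splits lie in a family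
`F₀` weighs `≥ 120`, then so does every side-symmetric split decomposition whose splits lie in `π⁻¹ F₀`, i.e. whose
`π`-images lie in `F₀`. [folklore] -/
theorem weight_ge_of_relabel (F₀ : Finset (Finset (Fin 5)))
    (h0 : ∀ (N : ℕ) (T : Finset (Fin N)) (S : Fin N → Finset (Fin 5)) (u w : Fin N → (Fin 5 → Fin 5) → ℂ),
      IsSplitDecomposition T S u w → SideSymmetric T S u w → (∀ t ∈ T, S t ∈ F₀) → Nat.factorial 5 ≤ laplaceWeight T S)
    (T : Finset (Fin N)) (S : Fin N → Finset (Fin 5)) (u w : Fin N → (Fin 5 → Fin 5) → ℂ)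
    (hdec : IsSplitDecomposition T S u w) (hsym : SideSymmetric T S u w) (π : Equiv.Perm (Fin 5))
    (hF : ∀ t ∈ T, (S t).image ⇑π ∈ F₀) : Nat.factorial 5 ≤ laplaceWeight T S := by
  rw [← laplaceWeight_relabel T S π]
  exact h0 N T _ _ _ (isSplitDecomposition_relabel T S u w π hdec) (sideSymmetric_relabel T S u w π hsym) hF

end LaplaceFiveRelabel

end Summit.ValiantsHypothesis.ValiantsHypothesis.Theorems.RigidityForcesSymmetryRankRigidMinimalRepr
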